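import Mathlib.Algebra.BigOperators.Group.Finset.Basic
import Mathlib.Data.Finset.Card
import Mathlib.Data.List.GetD
import Mathlib.Data.Nat.Find
import Mathlib.Logic.Function.Iterate
import Mathlib.Order.Interval.Finset.Nat
import HarnessLib

/-!
# Rooted tree decompositions in list form: parents, bags, ancestors

Topic `Literature/Combinatorics/SimpleGraph`, companion of `TreeDecomposition.lean` (abstract
tree decompositions, `treewidth`). A **rooted** tree decomposition in the normal form handed to and
produced by machines (Markov–Shi, *Simulating quantum computation by contracting tensor networks*,
§4, proof of Thm. 4.6, Step 2: the decomposition computed by the Robertson–Seymour algorithm and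
consumed by the contraction; Bodlaender–Kloks / Arnborg–Proskurowski dynamic programming "over a
rooted tree decomposition") is a list `par` of parent indices and a list `bags` of bags, bag `0`
being the root and parents carrying smaller indices than their children; vertices are natural
numbers. In this form condition (T3) ("the bags containing a vertex form a subtree") reads: *a
vertex of bag `t` that occurs in some earlier bag occurs in the parent bag of `t`*
(`IsRootedTDOn.rooted`), and all tree reasoning is arithmetic on indices:

* list utilities shared by the algorithms on such decompositions: `allAssign d vs` (all value lists
  for the variables `vs` over `{0, …, d-1}`; `allAssignCap`, the budgeted form a machine runs),
  `assignOf` (reading an association list, default `0`), `updList` (overriding a map along a list);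
* `parOf`, `bagOf` (total accessors), `IsRootedTDOn S par bags` (a rooted decomposition of a vertex
  set `S`: (T1) and rooted (T3); the edge condition (T2) is kept separate, as the consumers need it
  for different edge sets), `IsRootedTD nv` (the case `S = {0, …, nv-1}`), `IsRootedTDOn.induce`
  (restriction to a subset of the vertices: intersect the bags);
* `pr` (the parent map with the root fixed), `IsAnc par a t` (`a` is an ancestor of `t`: some
  iterate of `pr` maps `t` to `a`) and its order properties (`IsAnc.le`, `isAnc_total`: the
  ancestors of a node form a chain, `IsAnc.isAnc_pr_of_ne`, `exists_child_of_isAnc`);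
* the **first bag** of a vertex (`firstBag`) and the consequences of the rooted (T3):
  `mem_bagOf_iterate` (a vertex of bag `s` lies in every bag on the way up from `s` to its first
  bag), `isAnc_firstBag` (the first bag of a vertex is an ancestor of every bag containing it),
  `mem_bagOf_of_isAnc_of_isAnc` (a vertex lying in bags `s` and in an ancestor `a` of `s` lies in
  every bag between them);
* `below par bags c` (the vertices occurring in the subtree of `c`) and `mem_bagOf_parent_of_below`
  (a vertex occurring below two distinct children of `t`, or below a child of `t` and in a bag
  outside the subtree of that child, lies in `bag t`).

The separator properties built on these (Robertson–Seymour's balanced separators) are in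
`ListTreeDecompositionSeparators.lean`; the junction-tree evaluation of sum-of-products networks
along such a decomposition is `Literature/LinearAlgebra/TensorNetworks/JunctionTree.lean`.

## References

* I. L. Markov, Y. Shi, SIAM J. Comput. 38 (2008) 963–981, §2 ((T1)–(T3)), §4 (Thm. 4.6, Step 2).
* M. Cygan, F. V. Fomin, Ł. Kowalik, D. Lokshtanov, D. Marx, M. Pilipczuk, M. Pilipczuk,
  S. Saurabh, *Parameterized Algorithms*, Springer 2015, §7.2 (rooted/nice tree decompositions),
  Lemma 7.3 (bags separate the subtrees hanging below them).
-/

namespace Literature.Combinatorics.SimpleGraph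

namespace ListTD

/-! ### Accessors and the rooted conditions -/

/-- The parent of the bag index `t` (`0` beyond the list). [folklore] -/
def parOf (par : List ℕ) (t : ℕ) : ℕ := par.getD t 0

/-- The bag at index `t` (`[]` beyond the list). [folklore] -/
def bagOf (bags : List (List ℕ)) (t : ℕ) : List ℕ := bags.getD t []

/-- A bag within range is the list entry. [folklore] -/
theorem bagOf_eq_getElem {bags : List (List ℕ)} {t : ℕ} (h : t < bags.length) : bagOf bags t = bags[t] := by
  simp [bagOf, List.getD_eq_getElem?_getD, List.getElem?_eq_getElem h]

/-- Beyond the list the bag is empty. [folklore] -/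
theorem bagOf_eq_nil {bags : List (List ℕ)} {t : ℕ} (h : bags.length ≤ t) : bagOf bags t = [] := by
  simp [bagOf, List.getD_eq_getElem?_getD, List.getElem?_eq_none h]

/-- Beyond the list the parent is `0`. [folklore] -/
theorem parOf_eq_zero {par : List ℕ} {t : ℕ} (h : par.length ≤ t) : parOf par t = 0 := by
  simp [parOf, List.getD_eq_getElem?_getD, List.getElem?_eq_none h]

/-- **Rooted tree decompositions in list form** of the vertex set `S`: as many parents as bags, at
least one bag (the root `0`), parents of non-root bags carry smaller indices, bags are lists of
vertices of `S` without repetition, (T1) every vertex of `S` lies in a bag, and (T3) in rooted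
form: a vertex of bag `t` lying in an earlier bag lies in the parent bag of `t`. The edge
condition (T2) is not part of the structure. [cite: MarkovShi2008, §2 ((T1), (T3)) and §4 (proof of Thm 4.6, Step 2)] -/
structure IsRootedTDOn (S : Finset ℕ) (par : List ℕ) (bags : List (List ℕ)) : Prop where
  /-- One parent entry per bag. -/
  length_par : par.length = bags.length
  /-- There is a root. -/
  pos : 0 < bags.length
  /-- Parents carry smaller indices. -/
  par_lt : ∀ t, 0 < t → t < bags.length → parOf par t < t
  /-- Bags consist of vertices of `S`. -/
  bag_mem : ∀ t, ∀ v ∈ bagOf bags t, v ∈ S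
  /-- Bags have no repeated vertex. -/
  bag_nodup : ∀ t, (bagOf bags t).Nodup
  /-- (T1): every vertex lies in a bag. -/
  cover : ∀ v ∈ S, ∃ t, t < bags.length ∧ v ∈ bagOf bags t
  /-- (T3), rooted: a vertex of bag `t` that lies in an earlier bag lies in the parent bag. -/
  rooted : ∀ v s t, s < t → t < bags.length → v ∈ bagOf bags t → v ∈ bagOf bags s →
    v ∈ bagOf bags (parOf par t)

/-- Rooted tree decompositions of the vertices `< nv`. [cite: MarkovShi2008, §2 and §4 (Thm 4.6, Step 2)] -/
abbrev IsRootedTD (nv : ℕ) (par : List ℕ) (bags : List (List ℕ)) : Prop :=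
  IsRootedTDOn (Finset.range nv) par bags

/-- Bags of a bag list filtered bagwise. [folklore] -/
theorem bagOf_map_filter (bags : List (List ℕ)) (p : ℕ → Bool) (t : ℕ) :
    bagOf (bags.map fun B => B.filter p) t = (bagOf bags t).filter p := by
  by_cases ht : t < bags.length
  · rw [bagOf_eq_getElem (by simpa using ht), bagOf_eq_getElem ht, List.getElem_map]
  · rw [bagOf_eq_nil (by simpa using not_lt.1 ht), bagOf_eq_nil (not_lt.1 ht), List.filter_nil]

/-- **Restriction to a subset of the vertices**: intersecting every bag with `S' ⊆ S` gives a rooted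
decomposition of `S'` (same parents). [cite: CyganEtAl2015, §7.2 (decompositions of induced subgraphs)] -/
theorem IsRootedTDOn.induce {S S' : Finset ℕ} {par : List ℕ} {bags : List (List ℕ)}
    (hD : IsRootedTDOn S par bags) (hS' : S' ⊆ S) :
    IsRootedTDOn S' par (bags.map fun B => B.filter fun v => decide (v ∈ S')) := by
  have hbag : ∀ t, bagOf (bags.map fun B => B.filter fun v => decide (v ∈ S')) t =
      (bagOf bags t).filter fun v => decide (v ∈ S') := fun t => bagOf_map_filter bags _ t
  refine ⟨by simpa using hD.length_par, by simpa using hD.pos, fun t h0 ht => hD.par_lt t h0 (by simpa using ht),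
    fun t v hv => ?_, fun t => ?_, fun v hv => ?_, fun v s t hst ht hvt hvs => ?_⟩
  · rw [hbag] at hv
    simpa using (List.mem_filter.1 hv).2
  · rw [hbag]; exact (hD.bag_nodup t).filter _
  · obtain ⟨t, ht, hvt⟩ := hD.cover v (hS' hv)
    exact ⟨t, by simpa using ht, by rw [hbag]; exact List.mem_filter.2 ⟨hvt, by simpa using hv⟩⟩
  · rw [hbag] at hvt hvs ⊢
    obtain ⟨hvt, hvS⟩ := List.mem_filter.1 hvt
    exact List.mem_filter.2 ⟨hD.rooted v s t hst (by simpa using ht) hvt (List.mem_filter.1 hvs).1, hvS⟩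

/-! ### Value lists, association lists, overriding -/

/-- **All value lists** for the variables `vs` over the domain `{0, …, d-1}` (`d^{|vs|}` lists of
length `|vs|`, in lexicographic order). [folklore] -/
def allAssign (d : ℕ) : List ℕ → List (List ℕ)
  | [] => [[]]
  | _ :: vs => (List.range d).flatMap fun x => (allAssign d vs).map (List.cons x)

/-- The budgeted enumeration: all value lists if there are at most `cap` of them, else none.
[folklore] -/
def allAssignCap (d cap : ℕ) (vs : List ℕ) : List (List ℕ) :=
  if d ^ vs.length ≤ cap then allAssign d vs else []

/-- Membership in `allAssign`: the lists of the right length with entries `< d`. [folklore] -/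
theorem mem_allAssign {d : ℕ} : ∀ {vs : List ℕ} {l : List ℕ},
    l ∈ allAssign d vs ↔ l.length = vs.length ∧ ∀ x ∈ l, x < d
  | [], l => by
    cases l with
    | nil => simp [allAssign]
    | cons x l => simp [allAssign]
  | v :: vs, l => by
    cases l with
    | nil => simp [allAssign]
    | cons x l =>
      simp only [allAssign, List.mem_flatMap, List.mem_range, List.mem_map, List.cons.injEq,
        List.length_cons, Nat.add_right_cancel_iff, List.mem_cons, forall_eq_or_imp]
      constructor
      · rintro ⟨y, hy, l', hl', rfl, rfl⟩
        exact ⟨(mem_allAssign.1 hl').1, hy, (mem_allAssign.1 hl').2⟩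
      · rintro ⟨hlen, hx, hl⟩
        exact ⟨x, hx, l, mem_allAssign.2 ⟨hlen, hl⟩, rfl, rfl⟩

/-- `|allAssign d vs| = d^{|vs|}`. [folklore] -/
theorem length_allAssign (d : ℕ) : ∀ vs : List ℕ, (allAssign d vs).length = d ^ vs.length
  | [] => rfl
  | v :: vs => by
    simp only [allAssign, List.length_flatMap, List.length_map, length_allAssign d vs,
      List.length_cons]
    rw [List.map_const', List.sum_replicate, List.length_range, Nat.nsmul_eq_mul, pow_succ, mul_comm]

/-- Within budget, the budgeted enumeration is the full one. [folklore] -/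
theorem allAssignCap_eq {d cap : ℕ} {vs : List ℕ} (h : d ^ vs.length ≤ cap) :
    allAssignCap d cap vs = allAssign d vs := if_pos h

/-- A sum over `List.range d` is the sum over `Finset.range d`. [folklore] -/
theorem sum_map_range_eq {M : Type*} [AddCommMonoid M] (d : ℕ) (g : ℕ → M) :
    ((List.range d).map g).sum = ∑ x ∈ Finset.range d, g x := by
  induction d with
  | zero => simp
  | succ d ih => rw [List.range_succ, List.map_append, List.sum_append, ih, Finset.sum_range_succ]; simp

/-- Summing over the value lists of `v :: vs` is summing over the value of `v` and over the value
lists of `vs`. [folklore] -/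
theorem sum_map_allAssign_cons {M : Type*} [AddCommMonoid M] (d v : ℕ) (vs : List ℕ)
    (F : List ℕ → M) :
    ((allAssign d (v :: vs)).map F).sum =
      ∑ x ∈ Finset.range d, ((allAssign d vs).map fun l => F (x :: l)).sum := by
  have key : ∀ xs : List ℕ, ((xs.flatMap fun x => (allAssign d vs).map (List.cons x)).map F).sum =
      (xs.map fun x => ((allAssign d vs).map fun l => F (x :: l)).sum).sum := by
    intro xs
    induction xs with
    | nil => simp
    | cons x xs ih => simp [List.flatMap_cons, ih, List.map_map, Function.comp_def]
  rw [allAssign, key, sum_map_range_eq]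

/-- **Reading an association list**: the value bound to `v` by its first binding, `0` if unbound.
[folklore] -/
def assignOf (A : List (ℕ × ℕ)) (v : ℕ) : ℕ :=
  match A.lookup v with
  | some x => x
  | none => 0

/-- **Overriding** a map on the variables `P` by the value list `pv` (positionally; shorter
lists override a prefix). [folklore] -/
def updList (a : ℕ → ℕ) : List ℕ → List ℕ → (ℕ → ℕ)
  | v :: P, x :: pv => Function.update (updList a P pv) v x
  | _, _ => a

/-- Overriding does not touch variables outside `P`. [folklore] -/
theorem updList_of_not_mem (a : ℕ → ℕ) : ∀ {P : List ℕ} (pv : List ℕ) {w : ℕ}, w ∉ P →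
    updList a P pv w = a w
  | [], pv, w, _ => by cases pv <;> rfl
  | v :: P, [], w, _ => rfl
  | v :: P, x :: pv, w, hw => by
    simp only [List.mem_cons, not_or] at hw
    rw [updList, Function.update_of_ne hw.1, updList_of_not_mem a pv hw.2]

/-- Overriding commutes with an update at a variable outside `P`. [folklore] -/
theorem updList_update (a : ℕ → ℕ) : ∀ {P : List ℕ} (pv : List ℕ) {w : ℕ} (y : ℕ), w ∉ P →
    updList (Function.update a w y) P pv = Function.update (updList a P pv) w y
  | [], pv, w, y, _ => by cases pv <;> rfl
  | v :: P, [], w, y, _ => rfl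
  | v :: P, x :: pv, w, y, hw => by
    simp only [List.mem_cons, not_or] at hw
    rw [updList, updList, updList_update a pv y hw.2, Function.update_comm hw.1]

/-! ### Association lists -/

/-- Reading past a binding. [folklore] -/
theorem assignOf_cons (p : ℕ × ℕ) (A : List (ℕ × ℕ)) (v : ℕ) :
    assignOf (p :: A) v = if v = p.1 then p.2 else assignOf A v := by
  obtain ⟨k, x⟩ := p
  unfold assignOf
  rw [List.lookup_cons]
  by_cases h : v = k
  · subst h; simp
  · have hb : (v == k) = false := beq_false_of_ne h
    simp [hb, h]

/-- Reading the empty list gives `0`. [folklore] -/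
@[simp] theorem assignOf_nil (v : ℕ) : assignOf [] v = 0 := rfl

/-- A variable not among the keys reads `0`, whatever follows: reading a concatenation whose first
part does not bind `v`. [folklore] -/
theorem assignOf_append_of_not_mem {A B : List (ℕ × ℕ)} {v : ℕ} (h : v ∉ A.map Prod.fst) :
    assignOf (A ++ B) v = assignOf B v := by
  induction A with
  | nil => rfl
  | cons p A ih =>
    simp only [List.map_cons, List.mem_cons, not_or] at h
    rw [List.cons_append, assignOf_cons, if_neg h.1, ih h.2]

/-- Reading a concatenation whose first part binds `v`. [folklore] -/
theorem assignOf_append_of_mem {A B : List (ℕ × ℕ)} {v : ℕ} (h : v ∈ A.map Prod.fst) :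
    assignOf (A ++ B) v = assignOf A v := by
  induction A with
  | nil => simp at h
  | cons p A ih =>
    rw [List.cons_append, assignOf_cons, assignOf_cons]
    by_cases hv : v = p.1
    · rw [if_pos hv, if_pos hv]
    · rw [if_neg hv, if_neg hv]
      simp only [List.map_cons, List.mem_cons] at h
      exact ih (h.resolve_left hv)

/-- The keys of a zip are a prefix of the first list. [folklore] -/
theorem mem_of_mem_map_fst_zip {K : List ℕ} {xs : List ℕ} {v : ℕ} (h : v ∈ (K.zip xs).map Prod.fst) :
    v ∈ K := by
  induction K generalizing xs with
  | nil => simp at h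
  | cons k K ih =>
    cases xs with
    | nil => simp at h
    | cons x xs =>
      simp only [List.zip_cons_cons, List.map_cons, List.mem_cons] at h
      rcases h with rfl | h
      · exact List.mem_cons_self
      · exact List.mem_cons_of_mem _ (ih h)

/-- **Reading back a map**: the list `K` zipped with the values `K.map a` reads `a` on `K`.
[folklore] -/
theorem assignOf_zip_map {K : List ℕ} {a : ℕ → ℕ} {v : ℕ} (hv : v ∈ K) :
    assignOf (K.zip (K.map a)) v = a v := by
  induction K with
  | nil => simp at hv
  | cons k K ih =>
    rw [List.map_cons, List.zip_cons_cons, assignOf_cons]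
    by_cases h : v = k
    · subst h; simp
    · rw [if_neg h]
      exact ih ((List.mem_cons.1 hv).resolve_left h)

/-- **Reading back an override**: `P` zipped with `pv` reads, on `P`, the map overridden by `pv`.
[folklore] -/
theorem assignOf_zip_eq_updList (a : ℕ → ℕ) : ∀ {P : List ℕ} {pv : List ℕ} {v : ℕ},
    pv.length = P.length → v ∈ P → assignOf (P.zip pv) v = updList a P pv v
  | [], _, _, _, hv => by simp at hv
  | w :: P, [], _, hlen, _ => by simp at hlen
  | w :: P, x :: pv, v, hlen, hv => by
    rw [List.zip_cons_cons, assignOf_cons, updList]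
    by_cases h : v = w
    · subst h; simp
    · rw [if_neg h, Function.update_of_ne h]
      exact assignOf_zip_eq_updList a (by simpa using hlen) ((List.mem_cons.1 hv).resolve_left h)

/-! ### The parent map and ancestors -/

/-- **The parent map with the root fixed**: `pr par 0 = 0`, `pr par t = parOf par t` otherwise.
[folklore] -/
def pr (par : List ℕ) (t : ℕ) : ℕ := if t = 0 then 0 else parOf par t

/-- `pr par 0 = 0`. [folklore] -/
@[simp] theorem pr_zero (par : List ℕ) : pr par 0 = 0 := rfl

/-- Away from the root, `pr` is the parent. [folklore] -/
theorem pr_of_ne_zero (par : List ℕ) {t : ℕ} (ht : t ≠ 0) : pr par t = parOf par t := if_neg ht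

section Anc

variable {S : Finset ℕ} {par : List ℕ} {bags : List (List ℕ)}

/-- Under the rooted conditions the parent of a non-root index is smaller (also beyond the list,
where it is `0`). [folklore] -/
theorem pr_lt (hD : IsRootedTDOn S par bags) {t : ℕ} (ht : t ≠ 0) : pr par t < t := by
  rw [pr_of_ne_zero par ht]
  by_cases h : t < bags.length
  · exact hD.par_lt t (Nat.pos_of_ne_zero ht) h
  · rw [parOf_eq_zero (by rw [hD.length_par]; exact not_lt.1 h)]
    exact Nat.pos_of_ne_zero ht

/-- The parent index is at most the index. [folklore] -/
theorem pr_le (hD : IsRootedTDOn S par bags) (t : ℕ) : pr par t ≤ t := by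
  by_cases ht : t = 0
  · simp [ht]
  · exact (pr_lt hD ht).le

/-- Iterated parents do not increase. [folklore] -/
theorem iterate_pr_le (hD : IsRootedTDOn S par bags) (n t : ℕ) : (pr par)^[n] t ≤ t := by
  induction n with
  | zero => exact le_rfl
  | succ n ih => rw [Function.iterate_succ_apply']; exact (pr_le hD _).trans ih

/-- Iterated parents are antitone in the number of iterations. [folklore] -/
theorem iterate_pr_le_of_le (hD : IsRootedTDOn S par bags) {m n : ℕ} (h : m ≤ n) (t : ℕ) :
    (pr par)^[n] t ≤ (pr par)^[m] t := by
  obtain ⟨k, rfl⟩ := Nat.exists_eq_add_of_le h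
  rw [add_comm, Function.iterate_add_apply]
  exact iterate_pr_le hD k _

/-- Iterated parents of a bag index stay within range. [folklore] -/
theorem iterate_pr_lt_length (hD : IsRootedTDOn S par bags) (n : ℕ) {t : ℕ} (ht : t < bags.length) :
    (pr par)^[n] t < bags.length :=
  (iterate_pr_le hD n t).trans_lt ht

/-- **Ancestors**: `a` is an ancestor of `t` (reflexively) if some iterate of the parent map sends
`t` to `a`. [folklore] -/
def IsAnc (par : List ℕ) (a t : ℕ) : Prop := ∃ n, (pr par)^[n] t = a

/-- Every index is its own ancestor. [folklore] -/
theorem isAnc_refl (par : List ℕ) (t : ℕ) : IsAnc par t t := ⟨0, rfl⟩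

/-- The parent is an ancestor. [folklore] -/
theorem isAnc_pr (par : List ℕ) (t : ℕ) : IsAnc par (pr par t) t := ⟨1, rfl⟩

/-- Ancestry is transitive. [folklore] -/
theorem IsAnc.trans {a b t : ℕ} (hab : IsAnc par a b) (hbt : IsAnc par b t) : IsAnc par a t := by
  obtain ⟨m, rfl⟩ := hab
  obtain ⟨n, rfl⟩ := hbt
  exact ⟨m + n, by rw [Function.iterate_add_apply]⟩

/-- Ancestors carry smaller indices. [folklore] -/
theorem IsAnc.le (hD : IsRootedTDOn S par bags) {a t : ℕ} (h : IsAnc par a t) : a ≤ t := by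
  obtain ⟨n, rfl⟩ := h
  exact iterate_pr_le hD n t

/-- Ancestors of bag indices are bag indices. [folklore] -/
theorem IsAnc.lt_length (hD : IsRootedTDOn S par bags) {a t : ℕ} (h : IsAnc par a t) (ht : t < bags.length) :
    a < bags.length :=
  (h.le hD).trans_lt ht

/-- A proper ancestor is an ancestor of the parent. [folklore] -/
theorem IsAnc.isAnc_pr_of_ne {a t : ℕ} (h : IsAnc par a t) (hne : a ≠ t) : IsAnc par a (pr par t) := by
  obtain ⟨n, rfl⟩ := h
  cases n with
  | zero => exact absurd rfl hne
  | succ n => exact ⟨n, by rw [Function.iterate_succ_apply]⟩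

/-- An ancestor of a proper ancestor... : the ancestors of the parent are ancestors. [folklore] -/
theorem IsAnc.of_pr {a t : ℕ} (h : IsAnc par a (pr par t)) : IsAnc par a t :=
  h.trans (isAnc_pr par t)

/-- The only ancestor of the root is the root. [folklore] -/
theorem IsAnc.eq_zero {a : ℕ} (h : IsAnc par a 0) : a = 0 := by
  obtain ⟨n, rfl⟩ := h
  induction n with
  | zero => rfl
  | succ n ih => rw [Function.iterate_succ_apply, pr_zero, ih]

/-- **The ancestors of a node form a chain.** [folklore] -/
theorem isAnc_total {a b t : ℕ} (ha : IsAnc par a t) (hb : IsAnc par b t) : IsAnc par a b ∨ IsAnc par b a := by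
  obtain ⟨m, rfl⟩ := ha
  obtain ⟨n, rfl⟩ := hb
  rcases le_total m n with h | h
  · obtain ⟨k, rfl⟩ := Nat.exists_eq_add_of_le h
    exact Or.inr ⟨k, by rw [add_comm, Function.iterate_add_apply]⟩
  · obtain ⟨k, rfl⟩ := Nat.exists_eq_add_of_le h
    exact Or.inl ⟨k, by rw [add_comm, Function.iterate_add_apply]⟩

/-- Two ancestors of a common node with `a ≤ b`: then `a` is an ancestor of `b`. [folklore] -/
theorem isAnc_of_isAnc_of_le (hD : IsRootedTDOn S par bags) {a b t : ℕ} (ha : IsAnc par a t) (hb : IsAnc par b t)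
    (hab : a ≤ b) : IsAnc par a b := by
  rcases isAnc_total ha hb with h | h
  · exact h
  · have := h.le hD
    have hab' : a = b := le_antisymm hab this
    subst hab'
    exact isAnc_refl par a

/-- **The child through which an ancestor is reached**: a proper ancestor `a` of `s` is the parent
of a non-root node `c ≠ a` that is an ancestor of `s`. [folklore] -/
theorem exists_child_of_isAnc {a s : ℕ} (h : IsAnc par a s) (hne : a ≠ s) :
    ∃ c, c ≠ 0 ∧ c ≠ a ∧ pr par c = a ∧ IsAnc par c s := by
  classical
  set n₀ := Nat.find h with hn₀
  have hspec : (pr par)^[n₀] s = a := Nat.find_spec h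
  have hpos : n₀ ≠ 0 := by
    intro h0; rw [h0] at hspec; exact hne hspec.symm
  obtain ⟨n, hn⟩ := Nat.exists_eq_succ_of_ne_zero hpos
  have hc : (pr par)^[n] s ≠ a := Nat.find_min h (by omega)
  refine ⟨(pr par)^[n] s, fun h0 => hc ?_, hc, by rw [← hspec, hn, Function.iterate_succ_apply'], ⟨n, rfl⟩⟩
  rw [h0, ← hspec, hn, Function.iterate_succ_apply', h0, pr_zero]

/-! ### The first bag of a vertex and the rooted (T3) along ancestor chains -/

/-- **The first bag containing `v`** (its least index; `0` if there is none). [folklore] -/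
noncomputable def firstBag (bags : List (List ℕ)) (v : ℕ) : ℕ := by
  classical exact if h : ∃ t, t < bags.length ∧ v ∈ bagOf bags t then Nat.find h else 0

/-- The first bag is a bag containing the vertex. [folklore] -/
theorem firstBag_spec {v : ℕ} (h : ∃ t, t < bags.length ∧ v ∈ bagOf bags t) :
    firstBag bags v < bags.length ∧ v ∈ bagOf bags (firstBag bags v) := by
  classical
  unfold firstBag
  rw [dif_pos h]
  exact Nat.find_spec h

/-- No earlier bag contains the vertex. [folklore] -/
theorem firstBag_le {v t : ℕ} (ht : t < bags.length) (hv : v ∈ bagOf bags t) : firstBag bags v ≤ t := by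
  classical
  have h : ∃ t, t < bags.length ∧ v ∈ bagOf bags t := ⟨t, ht, hv⟩
  unfold firstBag
  rw [dif_pos h]
  exact Nat.find_min' h ⟨ht, hv⟩

/-- **Going up from a bag containing `v` one stays in bags containing `v` as long as one stays at or
below the first bag of `v`** (the rooted (T3), iterated). [cite: MarkovShi2008, §2 ((T3))] -/
theorem mem_bagOf_iterate (hD : IsRootedTDOn S par bags) {v s : ℕ} (hs : s < bags.length)
    (hv : v ∈ bagOf bags s) : ∀ n, firstBag bags v ≤ (pr par)^[n] s → v ∈ bagOf bags ((pr par)^[n] s)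
  | 0, _ => hv
  | n + 1, hle => by
    have hle' : firstBag bags v ≤ (pr par)^[n] s :=
      hle.trans (by rw [Function.iterate_succ_apply']; exact pr_le hD _)
    have ih := mem_bagOf_iterate hD hs hv n hle'
    rw [Function.iterate_succ_apply'] at hle ⊢
    set u := (pr par)^[n] s with hu
    by_cases hu0 : u = 0
    · rw [hu0, pr_zero]; rw [hu0] at ih; exact ih
    · rw [pr_of_ne_zero par hu0] at hle ⊢
      have hlt : parOf par u < u := by have := pr_lt hD hu0; rwa [pr_of_ne_zero par hu0] at this
      have hfb := firstBag_spec ⟨s, hs, hv⟩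
      exact hD.rooted v (firstBag bags v) u (by omega) (iterate_pr_lt_length hD n hs) ih hfb.2

/-- **The first bag of a vertex is an ancestor of every bag containing it.** [cite: MarkovShi2008, §2 ((T3))] -/
theorem isAnc_firstBag (hD : IsRootedTDOn S par bags) {v s : ℕ} (hs : s < bags.length)
    (hv : v ∈ bagOf bags s) : IsAnc par (firstBag bags v) s := by
  set m := firstBag bags v with hm
  -- while at or above `m`, either we are at `m` or the next step stays at or above `m`
  have hnext : ∀ n, m ≤ (pr par)^[n] s → (pr par)^[n] s = m ∨ m ≤ (pr par)^[n + 1] s := by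
    intro n hle
    rcases hle.eq_or_lt with heq | hlt
    · exact Or.inl heq.symm
    · right
      have hin := mem_bagOf_iterate hD hs hv n hle
      set u := (pr par)^[n] s with hu
      have hu0 : u ≠ 0 := by omega
      rw [Function.iterate_succ_apply', ← hu, pr_of_ne_zero par hu0]
      by_contra hcon
      rw [not_le] at hcon
      have hpar := hD.rooted v m u hlt (iterate_pr_lt_length hD n hs) hin (firstBag_spec ⟨s, hs, hv⟩).2
      have hlen : parOf par u < bags.length :=
        (hD.par_lt u (Nat.pos_of_ne_zero hu0) (iterate_pr_lt_length hD n hs)).trans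
          (iterate_pr_lt_length hD n hs)
      have := firstBag_le hlen hpar
      omega
  -- descend along the measure `(pr)^[n] s - m`
  suffices H : ∀ d n, (pr par)^[n] s - m = d → m ≤ (pr par)^[n] s → ∃ j, (pr par)^[n + j] s = m by
    obtain ⟨j, hj⟩ := H _ 0 rfl (firstBag_le hs hv)
    exact ⟨0 + j, hj⟩
  intro d
  induction d using Nat.strong_induction_on with
  | _ d ih =>
    intro n hd hle
    by_cases heq : (pr par)^[n] s = m
    · exact ⟨0, by simpa using heq⟩
    · have hle' : m ≤ (pr par)^[n + 1] s := (hnext n hle).resolve_left heq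
      have hn0 : (pr par)^[n] s ≠ 0 := by omega
      have hlt : (pr par)^[n + 1] s < (pr par)^[n] s := by
        rw [Function.iterate_succ_apply']
        exact pr_lt hD hn0
      obtain ⟨j, hj⟩ := ih ((pr par)^[n + 1] s - m) (by omega) (n + 1) rfl hle'
      exact ⟨j + 1, by rw [show n + (j + 1) = n + 1 + j by omega]; exact hj⟩

/-- **Between a bag and an ancestor through which the first bag is reached, the vertex is in every
bag**: if `v ∈ bag s`, `a` is an ancestor of `s` and the first bag of `v` is an ancestor of `a`,
then `v ∈ bag a`. [cite: MarkovShi2008, §2 ((T3))] -/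
theorem mem_bagOf_of_isAnc (hD : IsRootedTDOn S par bags) {v s a : ℕ} (hs : s < bags.length)
    (hv : v ∈ bagOf bags s) (ha : IsAnc par a s) (hma : IsAnc par (firstBag bags v) a) : v ∈ bagOf bags a := by
  obtain ⟨n, rfl⟩ := ha
  exact mem_bagOf_iterate hD hs hv n (hma.le hD)

/-- A vertex in bags `s` and `r`: if the first bag of the vertex is not below `c` but `c` is an
ancestor of `s`, then the vertex lies in the parent bag of `c`. [cite: CyganEtAl2015, Lemma 7.3] -/
theorem mem_bagOf_pr_of_not_isAnc (hD : IsRootedTDOn S par bags) {v s c : ℕ} (hs : s < bags.length)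
    (hv : v ∈ bagOf bags s) (hcs : IsAnc par c s) (hm : ¬ IsAnc par c (firstBag bags v)) :
    v ∈ bagOf bags (pr par c) := by
  have hms := isAnc_firstBag hD hs hv
  rcases isAnc_total hms hcs with h | h
  · -- the first bag is an ancestor of `c`, a proper one
    have hne : firstBag bags v ≠ c := fun he => hm (he ▸ isAnc_refl par _)
    exact mem_bagOf_of_isAnc hD hs hv ((isAnc_pr par c).trans hcs) (h.isAnc_pr_of_ne hne)
  · exact absurd h hm

/-! ### The vertices below a node -/

open scoped Classical in
/-- **The vertices occurring in the subtree of `c`**: those in a bag whose index has `c` as an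
ancestor. [cite: CyganEtAl2015, §7.2 (V_t, the vertices in the bags of the subtree rooted at t)] -/
noncomputable def below (par : List ℕ) (bags : List (List ℕ)) (c : ℕ) : Finset ℕ :=
  ((Finset.range bags.length).filter fun s => IsAnc par c s).biUnion fun s => (bagOf bags s).toFinset

/-- Membership below a node. [folklore] -/
theorem mem_below {c v : ℕ} : v ∈ below par bags c ↔ ∃ s, s < bags.length ∧ IsAnc par c s ∧ v ∈ bagOf bags s := by
  classical
  unfold below
  simp only [Finset.mem_biUnion, Finset.mem_filter, Finset.mem_range, List.mem_toFinset, and_assoc]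

/-- The bag of a node lies below it. [folklore] -/
theorem mem_below_self {c v : ℕ} (hc : c < bags.length) (hv : v ∈ bagOf bags c) : v ∈ below par bags c :=
  mem_below.2 ⟨c, hc, isAnc_refl par c, hv⟩

/-- Below is monotone along ancestry. [folklore] -/
theorem below_subset_of_isAnc {a c : ℕ} (h : IsAnc par a c) : below par bags c ⊆ below par bags a := fun v hv => by
  obtain ⟨s, hs, hcs, hvs⟩ := mem_below.1 hv
  exact mem_below.2 ⟨s, hs, h.trans hcs, hvs⟩

/-- Vertices below a node are vertices of `S`. [folklore] -/
theorem below_subset (hD : IsRootedTDOn S par bags) (c : ℕ) : below par bags c ⊆ S := fun v hv => by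
  obtain ⟨s, -, -, hvs⟩ := mem_below.1 hv
  exact hD.bag_mem s v hvs

/-- Everything lies below the root. [folklore] -/
theorem below_zero (hD : IsRootedTDOn S par bags) : below par bags 0 = S := by
  refine Finset.Subset.antisymm (below_subset hD 0) fun v hv => ?_
  obtain ⟨t, ht, hvt⟩ := hD.cover v hv
  refine mem_below.2 ⟨t, ht, ?_, hvt⟩
  -- `0` is an ancestor of everything: iterate `t` times
  refine ⟨t, ?_⟩
  have : ∀ n u, u ≤ n → (pr par)^[n] u = 0 := by
    intro n
    induction n with
    | zero => intro u hu; simpa using hu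
    | succ n ih =>
      intro u hu
      rw [Function.iterate_succ_apply]
      by_cases hu0 : u = 0
      · subst hu0; rw [pr_zero]; exact ih 0 (Nat.zero_le _)
      · exact ih _ (by have := pr_lt hD hu0; omega)
  exact this t t le_rfl

/-- **A vertex below a child `c` of `t` that is not in `bag t` is below no other child of `t` and in
no bag outside the subtree of `c`**, contrapositively: a vertex in a bag below `c` and in a bag `r`
not below `c` lies in the parent bag of `c`. [cite: CyganEtAl2015, Lemma 7.3] -/
theorem mem_bagOf_pr_of_mem_of_not_below (hD : IsRootedTDOn S par bags) {v c s r : ℕ}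
    (hs : s < bags.length) (hvs : v ∈ bagOf bags s) (hcs : IsAnc par c s)
    (hr : r < bags.length) (hvr : v ∈ bagOf bags r) (hcr : ¬ IsAnc par c r) : v ∈ bagOf bags (pr par c) := by
  refine mem_bagOf_pr_of_not_isAnc hD hs hvs hcs fun hcm => hcr ?_
  exact hcm.trans (isAnc_firstBag hD hr hvr)

/-- **Distinct children have only parent-bag vertices in common below them.** [cite: CyganEtAl2015, Lemma 7.3] -/
theorem mem_bagOf_of_below_of_below (hD : IsRootedTDOn S par bags) {v c c' t : ℕ} (hc0 : c ≠ 0) (hc'0 : c' ≠ 0)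
    (hcc' : c ≠ c') (hc : pr par c = t) (hc' : pr par c' = t)
    (hv : v ∈ below par bags c) (hv' : v ∈ below par bags c') : v ∈ bagOf bags t := by
  obtain ⟨s, hs, hcs, hvs⟩ := mem_below.1 hv
  obtain ⟨s', hs', hc's', hvs'⟩ := mem_below.1 hv'
  rw [← hc]
  refine mem_bagOf_pr_of_mem_of_not_below hD hs hvs hcs hs' hvs' fun hcs' => ?_
  -- `c` and `c'` would be comparable ancestors of `s'`, but siblings are not
  rcases isAnc_total hcs' hc's' with h | h
  · have := (h.isAnc_pr_of_ne hcc').le hD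
    rw [hc'] at this
    have := pr_lt hD hc0; omega
  · have := (h.isAnc_pr_of_ne (Ne.symm hcc')).le hD
    rw [hc] at this
    have := pr_lt hD hc'0; omega

/-- **A vertex below `t` outside `bag t` lies below a child of `t`.** [cite: CyganEtAl2015, §7.2] -/
theorem exists_child_of_mem_below {v t : ℕ} (hv : v ∈ below par bags t)
    (hvt : v ∉ bagOf bags t) : ∃ c, c ≠ 0 ∧ c ≠ t ∧ pr par c = t ∧ v ∈ below par bags c := by
  obtain ⟨s, hs, hts, hvs⟩ := mem_below.1 hv
  have hne : t ≠ s := fun h => hvt (h ▸ hvs)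
  obtain ⟨c, hc0, hct, hpc, hcs⟩ := exists_child_of_isAnc hts hne
  exact ⟨c, hc0, hct, hpc, mem_below.2 ⟨s, hs, hcs, hvs⟩⟩

end Anc

end ListTD

end Literature.Combinatorics.SimpleGraph
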